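import Literature.Algebra.Polynomial.CasasAlvero.TransferCorollaries
import Literature.Algebra.Polynomial.CasasAlvero.Degree6CandidatesPrime
import HarnessLib

/-!
# The Casas-Alvero conjecture in characteristic `0`: every degree `d ≤ 150` the literature covers, formally

For every field `K` of characteristic `0` and every `d ≤ 150` outside the explicit list of `48` exceptions below, `CA_d(K)` holds —
each case an instance of a theorem of this directory: `p^k` and `2p^k` ([GrafVonBothmerEtAl2007, Thm. 1]; `Transfer.lean`), `3p^k`
(`p ≥ 5`) and `4p^k` (`p ≥ 11`) ([CastryckLaterveerOunaies2012, Thm. 4]; `Transfer.lean`), `5p^k` for `p` outside the nine bad primes of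
degree `5` (`TransferCorollaries.lean`; degrees 65, 85, 95, 115, 145 here) and `6p^k` for `p` outside the `54` candidate bad primes of degree `6`
(`Degree6CandidatesPrime.lean`; here: 102).  The exceptions are `12` — PROVED in
[CastryckLaterveerOunaies2012, Thm. 5] by a three-week Magma computation per scenario that is not reproduced in this tree — the `27` degrees
`d ≤ 100` for which the conjecture is open —
`20, 24, 28, 30, 35, 36, 40, 42, 45, 48, 55, 56, 60, 63, 66, 70, 72, 77, 78, 80, 84, 88, 90, 91, 96, 99, 100` — and the analogous degrees up to `150`.
Remark (literature precision): the list of open degrees `≤ 100` printed in [CastryckLaterveerOunaies2012, (6).5] reads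
`…, 91, 98, 99, 100` — but `98 = 2·7²` is covered by [GrafVonBothmerEtAl2007, Thm. 1] (case `d = 98` below), while `96 = 2⁵·3` is of none
of the covered forms (`96 = 3·2⁵ = 6·2⁴` and `2` is a bad prime for the degrees `3` and `6`; `96 = 32·3` has digit `32 > 7`); so the
intended entry is presumably `96`.  For `100 < d ≤ 150` the excluded degrees are likewise exactly those of none of the forms covered by
[GrafVonBothmerEtAl2007, Thm. 1] and [CastryckLaterveerOunaies2012, Thms. 3, 4] with the bad-prime lists proved in this directory (no claim about
their status beyond that is made).  The theorem below is exactly what the tree proves, no more.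
-/

noncomputable section

open Polynomial

namespace Literature.Algebra.Polynomial.CasasAlvero

universe u

variable (K : Type u) [Field K] [CharZero K]

/-- **Characteristic `0`, every degree `d ≤ 150` except `12, 20, 24, 28, 30, 35, 36, 40, 42, 45, 48, 55, 56, 60, 63, 66, 70, 72, 77, 78, 80, 84, 88, 90, 91, 96, 99, 100, 104, 105, 108, 110, 112, 114, 117, 119, 120, 126, 130, 132, 133, 135, 136, 138, 140, 143, 144, 150`** (`12` is [CLO, Thm. 5], not formalised; the others
are of no form covered by the literature's theorems with the bad-prime lists of this directory). [cite: GrafVonBothmerEtAl2007, Thm. 1] [cite: CastryckLaterveerOunaies2012, Thm. 4] -/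
theorem holdsInDegree_of_le_150_of_charZero {d : ℕ} (hd : d ≤ 150)
    (h : d ∉ ({12, 20, 24, 28, 30, 35, 36, 40, 42, 45, 48, 55, 56, 60, 63, 66, 70, 72, 77, 78, 80, 84, 88, 90, 91, 96, 99, 100, 104, 105, 108, 110, 112, 114, 117, 119, 120, 126, 130, 132, 133, 135, 136, 138, 140, 143, 144, 150} : Finset ℕ)) : HoldsInDegree K d := by
  haveI : Fact (Nat.Prime 2) := ⟨by norm_num⟩
  haveI : Fact (Nat.Prime 3) := ⟨by norm_num⟩
  haveI : Fact (Nat.Prime 5) := ⟨by norm_num⟩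
  haveI : Fact (Nat.Prime 7) := ⟨by norm_num⟩
  haveI : Fact (Nat.Prime 11) := ⟨by norm_num⟩
  haveI : Fact (Nat.Prime 13) := ⟨by norm_num⟩
  haveI : Fact (Nat.Prime 17) := ⟨by norm_num⟩
  haveI : Fact (Nat.Prime 19) := ⟨by norm_num⟩
  haveI : Fact (Nat.Prime 23) := ⟨by norm_num⟩
  haveI : Fact (Nat.Prime 29) := ⟨by norm_num⟩
  haveI : Fact (Nat.Prime 31) := ⟨by norm_num⟩
  haveI : Fact (Nat.Prime 37) := ⟨by norm_num⟩
  haveI : Fact (Nat.Prime 41) := ⟨by norm_num⟩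
  haveI : Fact (Nat.Prime 43) := ⟨by norm_num⟩
  haveI : Fact (Nat.Prime 47) := ⟨by norm_num⟩
  haveI : Fact (Nat.Prime 53) := ⟨by norm_num⟩
  haveI : Fact (Nat.Prime 59) := ⟨by norm_num⟩
  haveI : Fact (Nat.Prime 61) := ⟨by norm_num⟩
  haveI : Fact (Nat.Prime 67) := ⟨by norm_num⟩
  haveI : Fact (Nat.Prime 71) := ⟨by norm_num⟩
  haveI : Fact (Nat.Prime 73) := ⟨by norm_num⟩
  haveI : Fact (Nat.Prime 79) := ⟨by norm_num⟩
  haveI : Fact (Nat.Prime 83) := ⟨by norm_num⟩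
  haveI : Fact (Nat.Prime 89) := ⟨by norm_num⟩
  haveI : Fact (Nat.Prime 97) := ⟨by norm_num⟩
  haveI : Fact (Nat.Prime 101) := ⟨by norm_num⟩
  haveI : Fact (Nat.Prime 103) := ⟨by norm_num⟩
  haveI : Fact (Nat.Prime 107) := ⟨by norm_num⟩
  haveI : Fact (Nat.Prime 109) := ⟨by norm_num⟩
  haveI : Fact (Nat.Prime 113) := ⟨by norm_num⟩
  haveI : Fact (Nat.Prime 127) := ⟨by norm_num⟩
  haveI : Fact (Nat.Prime 131) := ⟨by norm_num⟩
  haveI : Fact (Nat.Prime 137) := ⟨by norm_num⟩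
  haveI : Fact (Nat.Prime 139) := ⟨by norm_num⟩
  haveI : Fact (Nat.Prime 149) := ⟨by norm_num⟩
  interval_cases d
  · exact holdsInDegree_zero K
  · simpa using holdsInDegree_prime_pow_of_charZero K 2 0
  · simpa using holdsInDegree_prime_pow_of_charZero K 2 1
  · simpa using holdsInDegree_prime_pow_of_charZero K 3 1
  · simpa using holdsInDegree_prime_pow_of_charZero K 2 2
  · simpa using holdsInDegree_prime_pow_of_charZero K 5 1
  · simpa using holdsInDegree_two_mul_prime_pow_of_charZero K 3 1
  · simpa using holdsInDegree_prime_pow_of_charZero K 7 1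
  · simpa using holdsInDegree_prime_pow_of_charZero K 2 3
  · simpa using holdsInDegree_prime_pow_of_charZero K 3 2
  · simpa using holdsInDegree_two_mul_prime_pow_of_charZero K 5 1
  · simpa using holdsInDegree_prime_pow_of_charZero K 11 1
  · exact absurd (by decide) h
  · simpa using holdsInDegree_prime_pow_of_charZero K 13 1
  · simpa using holdsInDegree_two_mul_prime_pow_of_charZero K 7 1
  · simpa using holdsInDegree_three_mul_prime_pow_of_charZero K 5 (by norm_num) 1
  · simpa using holdsInDegree_prime_pow_of_charZero K 2 4
  · simpa using holdsInDegree_prime_pow_of_charZero K 17 1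
  · simpa using holdsInDegree_two_mul_prime_pow_of_charZero K 3 2
  · simpa using holdsInDegree_prime_pow_of_charZero K 19 1
  · exact absurd (by decide) h
  · simpa using holdsInDegree_three_mul_prime_pow_of_charZero K 7 (by norm_num) 1
  · simpa using holdsInDegree_two_mul_prime_pow_of_charZero K 11 1
  · simpa using holdsInDegree_prime_pow_of_charZero K 23 1
  · exact absurd (by decide) h
  · simpa using holdsInDegree_prime_pow_of_charZero K 5 2
  · simpa using holdsInDegree_two_mul_prime_pow_of_charZero K 13 1
  · simpa using holdsInDegree_prime_pow_of_charZero K 3 3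
  · exact absurd (by decide) h
  · simpa using holdsInDegree_prime_pow_of_charZero K 29 1
  · exact absurd (by decide) h
  · simpa using holdsInDegree_prime_pow_of_charZero K 31 1
  · simpa using holdsInDegree_prime_pow_of_charZero K 2 5
  · simpa using holdsInDegree_three_mul_prime_pow_of_charZero K 11 (by norm_num) 1
  · simpa using holdsInDegree_two_mul_prime_pow_of_charZero K 17 1
  · exact absurd (by decide) h
  · exact absurd (by decide) h
  · simpa using holdsInDegree_prime_pow_of_charZero K 37 1
  · simpa using holdsInDegree_two_mul_prime_pow_of_charZero K 19 1
  · simpa using holdsInDegree_three_mul_prime_pow_of_charZero K 13 (by norm_num) 1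
  · exact absurd (by decide) h
  · simpa using holdsInDegree_prime_pow_of_charZero K 41 1
  · exact absurd (by decide) h
  · simpa using holdsInDegree_prime_pow_of_charZero K 43 1
  · simpa using holdsInDegree_four_mul_prime_pow_of_charZero K 11 (by norm_num) 1
  · exact absurd (by decide) h
  · simpa using holdsInDegree_two_mul_prime_pow_of_charZero K 23 1
  · simpa using holdsInDegree_prime_pow_of_charZero K 47 1
  · exact absurd (by decide) h
  · simpa using holdsInDegree_prime_pow_of_charZero K 7 2
  · simpa using holdsInDegree_two_mul_prime_pow_of_charZero K 5 2
  · simpa using holdsInDegree_three_mul_prime_pow_of_charZero K 17 (by norm_num) 1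
  · simpa using holdsInDegree_four_mul_prime_pow_of_charZero K 13 (by norm_num) 1
  · simpa using holdsInDegree_prime_pow_of_charZero K 53 1
  · simpa using holdsInDegree_two_mul_prime_pow_of_charZero K 3 3
  · exact absurd (by decide) h
  · exact absurd (by decide) h
  · simpa using holdsInDegree_three_mul_prime_pow_of_charZero K 19 (by norm_num) 1
  · simpa using holdsInDegree_two_mul_prime_pow_of_charZero K 29 1
  · simpa using holdsInDegree_prime_pow_of_charZero K 59 1
  · exact absurd (by decide) h
  · simpa using holdsInDegree_prime_pow_of_charZero K 61 1
  · simpa using holdsInDegree_two_mul_prime_pow_of_charZero K 31 1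
  · exact absurd (by decide) h
  · simpa using holdsInDegree_prime_pow_of_charZero K 2 6
  · simpa using holdsInDegree_five_mul_prime_pow_of_charZero K 13 (by norm_num) (by norm_num) (by norm_num) (by norm_num) (by norm_num) (by norm_num) (by norm_num) (by norm_num) (by norm_num) 1
  · exact absurd (by decide) h
  · simpa using holdsInDegree_prime_pow_of_charZero K 67 1
  · simpa using holdsInDegree_four_mul_prime_pow_of_charZero K 17 (by norm_num) 1
  · simpa using holdsInDegree_three_mul_prime_pow_of_charZero K 23 (by norm_num) 1
  · exact absurd (by decide) h
  · simpa using holdsInDegree_prime_pow_of_charZero K 71 1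
  · exact absurd (by decide) h
  · simpa using holdsInDegree_prime_pow_of_charZero K 73 1
  · simpa using holdsInDegree_two_mul_prime_pow_of_charZero K 37 1
  · simpa using holdsInDegree_three_mul_prime_pow_of_charZero K 5 (by norm_num) 2
  · simpa using holdsInDegree_four_mul_prime_pow_of_charZero K 19 (by norm_num) 1
  · exact absurd (by decide) h
  · exact absurd (by decide) h
  · simpa using holdsInDegree_prime_pow_of_charZero K 79 1
  · exact absurd (by decide) h
  · simpa using holdsInDegree_prime_pow_of_charZero K 3 4
  · simpa using holdsInDegree_two_mul_prime_pow_of_charZero K 41 1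
  · simpa using holdsInDegree_prime_pow_of_charZero K 83 1
  · exact absurd (by decide) h
  · simpa using holdsInDegree_five_mul_prime_pow_of_charZero K 17 (by norm_num) (by norm_num) (by norm_num) (by norm_num) (by norm_num) (by norm_num) (by norm_num) (by norm_num) (by norm_num) 1
  · simpa using holdsInDegree_two_mul_prime_pow_of_charZero K 43 1
  · simpa using holdsInDegree_three_mul_prime_pow_of_charZero K 29 (by norm_num) 1
  · exact absurd (by decide) h
  · simpa using holdsInDegree_prime_pow_of_charZero K 89 1
  · exact absurd (by decide) h
  · exact absurd (by decide) h
  · simpa using holdsInDegree_four_mul_prime_pow_of_charZero K 23 (by norm_num) 1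
  · simpa using holdsInDegree_three_mul_prime_pow_of_charZero K 31 (by norm_num) 1
  · simpa using holdsInDegree_two_mul_prime_pow_of_charZero K 47 1
  · simpa using holdsInDegree_five_mul_prime_pow_of_charZero K 19 (by norm_num) (by norm_num) (by norm_num) (by norm_num) (by norm_num) (by norm_num) (by norm_num) (by norm_num) (by norm_num) 1
  · exact absurd (by decide) h
  · simpa using holdsInDegree_prime_pow_of_charZero K 97 1
  · simpa using holdsInDegree_two_mul_prime_pow_of_charZero K 7 2
  · exact absurd (by decide) h
  · exact absurd (by decide) h
  · simpa using holdsInDegree_prime_pow_of_charZero K 101 1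
  · simpa using holdsInDegree_six_mul_prime_pow_of_charZero_of_not_mem K 17 (by decide) 1
  · simpa using holdsInDegree_prime_pow_of_charZero K 103 1
  · exact absurd (by decide) h
  · exact absurd (by decide) h
  · simpa using holdsInDegree_two_mul_prime_pow_of_charZero K 53 1
  · simpa using holdsInDegree_prime_pow_of_charZero K 107 1
  · exact absurd (by decide) h
  · simpa using holdsInDegree_prime_pow_of_charZero K 109 1
  · exact absurd (by decide) h
  · simpa using holdsInDegree_three_mul_prime_pow_of_charZero K 37 (by norm_num) 1
  · exact absurd (by decide) h
  · simpa using holdsInDegree_prime_pow_of_charZero K 113 1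
  · exact absurd (by decide) h
  · simpa using holdsInDegree_five_mul_prime_pow_of_charZero K 23 (by norm_num) (by norm_num) (by norm_num) (by norm_num) (by norm_num) (by norm_num) (by norm_num) (by norm_num) (by norm_num) 1
  · simpa using holdsInDegree_four_mul_prime_pow_of_charZero K 29 (by norm_num) 1
  · exact absurd (by decide) h
  · simpa using holdsInDegree_two_mul_prime_pow_of_charZero K 59 1
  · exact absurd (by decide) h
  · exact absurd (by decide) h
  · simpa using holdsInDegree_prime_pow_of_charZero K 11 2
  · simpa using holdsInDegree_two_mul_prime_pow_of_charZero K 61 1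
  · simpa using holdsInDegree_three_mul_prime_pow_of_charZero K 41 (by norm_num) 1
  · simpa using holdsInDegree_four_mul_prime_pow_of_charZero K 31 (by norm_num) 1
  · simpa using holdsInDegree_prime_pow_of_charZero K 5 3
  · exact absurd (by decide) h
  · simpa using holdsInDegree_prime_pow_of_charZero K 127 1
  · simpa using holdsInDegree_prime_pow_of_charZero K 2 7
  · simpa using holdsInDegree_three_mul_prime_pow_of_charZero K 43 (by norm_num) 1
  · exact absurd (by decide) h
  · simpa using holdsInDegree_prime_pow_of_charZero K 131 1
  · exact absurd (by decide) h
  · exact absurd (by decide) h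
  · simpa using holdsInDegree_two_mul_prime_pow_of_charZero K 67 1
  · exact absurd (by decide) h
  · exact absurd (by decide) h
  · simpa using holdsInDegree_prime_pow_of_charZero K 137 1
  · exact absurd (by decide) h
  · simpa using holdsInDegree_prime_pow_of_charZero K 139 1
  · exact absurd (by decide) h
  · simpa using holdsInDegree_three_mul_prime_pow_of_charZero K 47 (by norm_num) 1
  · simpa using holdsInDegree_two_mul_prime_pow_of_charZero K 71 1
  · exact absurd (by decide) h
  · exact absurd (by decide) h
  · simpa using holdsInDegree_five_mul_prime_pow_of_charZero K 29 (by norm_num) (by norm_num) (by norm_num) (by norm_num) (by norm_num) (by norm_num) (by norm_num) (by norm_num) (by norm_num) 1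
  · simpa using holdsInDegree_two_mul_prime_pow_of_charZero K 73 1
  · simpa using holdsInDegree_three_mul_prime_pow_of_charZero K 7 (by norm_num) 2
  · simpa using holdsInDegree_four_mul_prime_pow_of_charZero K 37 (by norm_num) 1
  · simpa using holdsInDegree_prime_pow_of_charZero K 149 1
  · exact absurd (by decide) h

set_option maxRecDepth 16384 in
/-- The number of degrees `1 ≤ d ≤ 150` covered: `102` of `150`. [cite: CastryckLaterveerOunaies2012, Thm. 4] -/
theorem card_coveredDegrees_le_150 :
    ((Finset.Icc 1 150).filter (fun d => d ∉ ({12, 20, 24, 28, 30, 35, 36, 40, 42, 45, 48, 55, 56, 60, 63, 66, 70, 72, 77, 78, 80, 84, 88, 90, 91, 96, 99, 100, 104, 105, 108, 110, 112, 114, 117, 119, 120, 126, 130, 132, 133, 135, 136, 138, 140, 143, 144, 150} : Finset ℕ))).card = 102 := by decide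

end Literature.Algebra.Polynomial.CasasAlvero
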